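import Literature.NumberTheory.Sieve.BombieriFriedlanderIwaniecTheorem5Weights
import HarnessLib

/-!
# Bombieri–Friedlander–Iwaniec 1986, Theorem 5 — step 2: Poisson summation for the smoothed sums

Topic `Literature/NumberTheory/Sieve`; second file of the formalisation of the provable part of
the proof of Theorem 5 of E. Bombieri, J. B. Friedlander, H. Iwaniec, *Primes in arithmetic
progressions to large moduli*, Acta Math. 156 (1986), 203–251, §12 (pp. 235–237); it continues
`BombieriFriedlanderIwaniecTheorem5Weights` (the smooth weight `α = BFI.bump M Y` and the smoothing
error (12.1)).  Everything here is PROVED; no named facts are introduced.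

BFI, p. 236: "Now, applying Lemma 2 we get
`∑_{m ≡ a n̄ (qr)} α(m) = (qr)⁻¹ ∑_{|h| ≤ H} α̂(h/qr) e(−ah n̄/qr) + O(Q⁻¹R⁻¹)` with `H = x^ε QR M⁻¹`
and `φ(qr)⁻¹ ∑_{(m,qr)=1} α(m) = (qr)⁻¹ α̂(0) + O(Q⁻¹R⁻¹ τ(qr))`.  Hence
`𝒟(M,N,Q,R) = ∑_{q∼Q} ∑_{r∼R} γ_q δ_r (qr)⁻¹ ∑_{n∼N,(n,qr)=1} β_n ∑_{1≤|h|≤H} α̂(h/qr) e(−ahn̄/qr)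
  + O(‖β‖ M^{1/2} x^{1/2−ε/2})`."
This file proves the corresponding EXACT statements, one modulus `k = qr` at a time, with explicit
error terms (the asymptotic evaluation `O(…)` is left to the assembly file):

## Contents

* `BFI.sum_filter_natCast_eq_tsum` — Poisson summation over one residue class in finite form:
  `∑_{0≤m≤L, m≡c (k)} F(m) = k⁻¹ ∑_{h∈ℤ} e(ch/k) 𝓕F(h/k)` for smooth compactly supported `F`
  vanishing at the integers outside `[0, L]` (from the tree's
  `FriedlanderIwaniecPrimes.tsum_arithProg_eq_tsum_fourier`; Mathlib's `𝓕f(ξ) = ∫ f(t) e(−tξ) dt`,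
  BFI's `f̂(η) = ∫ f(ξ) e(ξη) dξ` — the sign is immaterial below).  This is the untruncated form of
  BFI's Lemma 2 (p. 209).
* `BFI.sum_filter_coprime_eq_sum_divisors` (`∑_{(m,k)=1} = ∑_{d∣k} μ(d) ∑_{d∣m}`),
  `BFI.sum_divisors_moebius_div` (`∑_{d∣k} μ(d)/d = φ(k)/k`).
* `BFI.tsum_int_eq_add_sum_add_tsum` — splitting `∑_{h∈ℤ}` into `h = 0`, `1 ≤ |h| ≤ H₀` and the
  tail; `BFI.fcoef M Y k h = 𝓕α(h/k)`; the tail bounds `BFI.sum_Ioc_norm_fcoef_le`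
  (`∑_{K<h≤N}(|Φ_k(h)|+|Φ_k(−h)|) ≤ 16 K_j Y⁻ʲ Y (k/2π)ʲ (K+1)^{1−j} =: BFI.tailBound Y j k K`, by
  repeated partial integration) and `BFI.sum_Icc_norm_fcoef_le` (all `h ≠ 0`, any split point).
* `BFI.classSum`/`BFI.coprimeSum` (`A(k,c) = ∑_{m≡c} α(m)`, `A*(k) = ∑_{(m,k)=1} α(m)`),
  `BFI.twCoef`, `BFI.oscSum` (the truncated two-sided oscillatory sum `∑_{1≤|h|≤H₀} e(ch/k)𝓕α(h/k)`),
  `BFI.alphaHat = 𝓕α(0)`;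
  **`BFI.norm_classSum_sub_le`**: `‖A(k,c) − k⁻¹(α̂₀ + oscSum)‖ ≤ k⁻¹ tailBound`;
  **`BFI.norm_coprimeSum_sub_le`**: `‖A*(k) − α̂₀ φ(k)/k‖ ≤ ∑_{d∣k} d⁻¹ (2K(d)(M+2Y) + tailBound(d))`
  (Möbius inversion and Poisson modulo each `d ∣ k`).
* `BFI.bracketW` (the bracket of (3.1) at one modulus), `BFI.dispDw_eq_sum_bracketW`, the
  rearrangements `BFI.sum_congr_eq_sum_filter`, `BFI.sum_coprime_eq_mul`, and
  **`BFI.norm_bracketW_bump_sub_le`**: at a modulus `k` coprime to `a`,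
  `‖bracketW(k; α) − k⁻¹ ∑_{(n,k)=1} β_n oscSum(k, a n̄, H₀)‖ ≤ ∑|β_n| (k⁻¹ tailBound + φ(k)⁻¹ ∑_{d∣k} …)`
  — the main terms `α̂₀/k` of the congruence and coprimality sums cancel exactly.

## References

* E. Bombieri, J. B. Friedlander, H. Iwaniec, Acta Math. 156 (1986), 203–251, §2 Lemma 2 p. 209,
  §12 p. 236. [BombieriFriedlanderIwaniecActa1986]
-/

noncomputable section

open Finset Real MeasureTheory
open scoped ArithmeticFunction.sigma ContDiff FourierTransform

namespace Literature.NumberTheory.Sieve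

namespace BFI

open FriedlanderIwaniecPrimes in
/-- **Poisson summation over one residue class, finite form.**  For a smooth compactly supported
`F : ℝ → ℂ` vanishing at the negative integers and at the integers `> L`, `k ≥ 1` and a class
`c (mod k)`:  `∑_{0 ≤ m ≤ L, m ≡ c (k)} F(m) = k⁻¹ ∑_{h ∈ ℤ} e(c h/k) 𝓕F(h/k)` (`c` = the least
residue).  This is the Poisson formula behind BFI's Lemma 2 (p. 209), without truncation.
[cite: BombieriFriedlanderIwaniecActa1986, §2 Lemma 2 p. 209] -/
theorem sum_filter_natCast_eq_tsum {F : ℝ → ℂ} (hF : ContDiff ℝ ∞ F) (hFc : HasCompactSupport F)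
    {L : ℕ} (hFL : ∀ m : ℕ, F m ≠ 0 → m ≤ L) (hFneg : ∀ m : ℤ, m < 0 → F m = 0)
    {k : ℕ} (hk : 0 < k) (c : ZMod k) :
    ∑ m ∈ (Finset.range (L + 1)).filter (fun m : ℕ => (m : ZMod k) = c), F m =
      (k : ℂ)⁻¹ * ∑' h : ℤ, (𝐞 ((c.val : ℝ) * h / k) : ℂ) * 𝓕 F ((h : ℝ) / k) := by
  haveI : NeZero k := ⟨hk.ne'⟩
  have key := tsum_arithProg_eq_tsum_fourier hF hFc hk (c.val : ℤ)
  push_cast at key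
  rw [← key]
  -- the `ℤ`-indexed sum is finitely supported on `0 ≤ j ≤ L`
  set f : ℤ → ℂ := fun j => F ((c.val : ℝ) + (k : ℝ) * (j : ℝ)) with hf
  have hcv : c.val < k := ZMod.val_lt c
  have hzero : ∀ j ∉ (Finset.range (L + 1)).map Nat.castEmbedding, f j = 0 := by
    intro j hj
    simp only [Finset.mem_map, Finset.mem_range, Nat.castEmbedding_apply, not_exists, not_and] at hj
    simp only [hf]
    rcases lt_or_ge j 0 with hj0 | hj0
    · -- `j < 0`: the argument is a negative integer
      have h1 : ((c.val : ℤ) + k * j : ℤ) < 0 := by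
        have : (k : ℤ) * j ≤ (k : ℤ) * (-1) := by
          exact mul_le_mul_of_nonneg_left (by omega) (by positivity)
        have hcv' : (c.val : ℤ) < k := by exact_mod_cast hcv
        linarith
      have := hFneg _ h1
      push_cast at this
      exact this
    · -- `j ≥ 0`, hence `j > L`
      obtain ⟨j', rfl⟩ := Int.eq_ofNat_of_zero_le hj0
      have hj' : L < j' := by
        by_contra hle
        exact hj j' (by omega) rfl
      by_contra hne
      have hm := hFL (c.val + k * j') (by push_cast at hne ⊢; exact hne)
      have : j' ≤ c.val + k * j' := by nlinarith
      omega
  rw [tsum_eq_sum hzero, Finset.sum_map]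
  simp only [Nat.castEmbedding_apply, hf]
  -- now both sides are finite sums over `ℕ`
  have hcast : ∀ j : ℕ, F ((c.val : ℝ) + (k : ℝ) * ((j : ℤ) : ℝ)) = F ((c.val + k * j : ℕ) : ℝ) := by
    intro j; push_cast; ring_nf
  simp_rw [hcast]
  -- reindex by `m = c.val + k j`
  have hinj : Set.InjOn (fun j : ℕ => c.val + k * j) (Finset.range (L + 1) : Set ℕ) := by
    intro j₁ _ j₂ _ h
    have : k * j₁ = k * j₂ := by simpa using h
    exact Nat.eq_of_mul_eq_mul_left hk this
  rw [← Finset.sum_image (f := fun m : ℕ => F (m : ℝ)) hinj]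
  apply Finset.sum_subset
  · intro m hm
    rw [Finset.mem_filter, Finset.mem_range] at hm
    rw [Finset.mem_image]
    refine ⟨m / k, Finset.mem_range.2 ?_, ?_⟩
    · exact lt_of_le_of_lt (Nat.div_le_self m k) hm.1
    · have h1 : m % k = c.val := by
        rw [← ZMod.val_natCast, hm.2]
      have h2 := Nat.div_add_mod m k
      omega
  · intro m hm hm'
    rw [Finset.mem_image] at hm
    obtain ⟨j, hj, rfl⟩ := hm
    rw [Finset.mem_filter, Finset.mem_range, not_and_or] at hm'
    rcases hm' with h | h
    · by_contra hne
      exact h (Nat.lt_add_one_iff.2 (hFL _ hne))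
    · exfalso
      apply h
      push_cast
      rw [ZMod.natCast_self, zero_mul, add_zero, ZMod.natCast_zmod_val]


/-! ### Möbius inversion of the coprimality condition -/

/-- `∑_{m ∈ S, (m,k)=1} f(m) = ∑_{d ∣ k} μ(d) ∑_{m ∈ S, d ∣ m} f(m)` for `k ≥ 1`. [folklore] -/
theorem sum_filter_coprime_eq_sum_divisors (S : Finset ℕ) (f : ℕ → ℂ) {k : ℕ} (hk : 0 < k) :
    ∑ m ∈ S.filter (fun m => m.Coprime k), f m =
      ∑ d ∈ k.divisors, (ArithmeticFunction.moebius d : ℂ) * ∑ m ∈ S.filter (fun m => d ∣ m), f m := by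
  classical
  have hind : ∀ m : ℕ, (if m.Coprime k then (1 : ℂ) else 0) =
      ∑ d ∈ k.divisors, if d ∣ m then (ArithmeticFunction.moebius d : ℂ) else 0 := by
    intro m
    have h1 : ∑ d ∈ (Nat.gcd m k).divisors, (ArithmeticFunction.moebius d : ℂ) =
        if Nat.gcd m k = 1 then 1 else 0 := by
      have h := congrArg (fun f : ArithmeticFunction ℂ => f (Nat.gcd m k))
        (ArithmeticFunction.coe_zeta_mul_coe_moebius (R := ℂ))
      simpa only [ArithmeticFunction.coe_zeta_mul_apply, ArithmeticFunction.intCoe_apply,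
        ArithmeticFunction.one_apply] using h
    have hg : (Nat.gcd m k).divisors = k.divisors.filter (· ∣ m) := by
      ext d
      simp only [Nat.mem_divisors, Finset.mem_filter, Nat.dvd_gcd_iff, ne_eq,
        Nat.gcd_eq_zero_iff, hk.ne', and_false, not_false_eq_true, and_true]
      tauto
    rw [hg, Finset.sum_filter] at h1
    rw [h1]
  rw [Finset.sum_filter]
  have e1 : ∀ m ∈ S, (if m.Coprime k then f m else 0) =
      ∑ d ∈ k.divisors, if d ∣ m then (ArithmeticFunction.moebius d : ℂ) * f m else 0 := by
    intro m _
    have h := congrArg (fun z : ℂ => z * f m) (hind m)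
    simp only [ite_mul, one_mul, zero_mul, Finset.sum_mul] at h
    exact h
  rw [Finset.sum_congr rfl e1, Finset.sum_comm]
  refine Finset.sum_congr rfl fun d _ => ?_
  rw [Finset.sum_filter, Finset.mul_sum]
  refine Finset.sum_congr rfl fun m _ => ?_
  split_ifs <;> simp

/-- `∑_{d ∣ k} μ(d)/d = φ(k)/k` for `k ≥ 1` (`φ = μ ∗ id`). [folklore] -/
theorem sum_divisors_moebius_div (k : ℕ) (hk : 0 < k) :
    ∑ d ∈ k.divisors, (ArithmeticFunction.moebius d : ℂ) / d = (Nat.totient k : ℂ) / k := by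
  have key : ∀ n > 0, ∑ x ∈ n.divisorsAntidiagonal,
      (ArithmeticFunction.moebius x.fst : ℤ) • ((x.snd : ℕ) : ℤ) = (Nat.totient n : ℤ) := by
    refine (ArithmeticFunction.sum_eq_iff_sum_smul_moebius_eq (R := ℤ)
      (f := fun n => (Nat.totient n : ℤ)) (g := fun n => ((n : ℕ) : ℤ))).mp ?_
    intro n _
    exact_mod_cast Nat.sum_totient n
  have h := key k hk
  rw [Nat.sum_divisorsAntidiagonal (f := fun a b => (ArithmeticFunction.moebius a : ℤ) • ((b : ℕ) : ℤ))]
    at h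
  have h' := congrArg (fun z : ℤ => (z : ℂ) / k) h
  simp only [zsmul_eq_mul, Int.cast_id, Int.cast_sum, Int.cast_mul, Int.cast_natCast,
    Finset.sum_div] at h'
  rw [← h']
  refine Finset.sum_congr rfl fun d hd => ?_
  have hdk : d ∣ k := Nat.dvd_of_mem_divisors hd
  have hd0 : (d : ℂ) ≠ 0 := by exact_mod_cast (Nat.pos_of_mem_divisors hd).ne'
  have hk0 : (k : ℂ) ≠ 0 := by exact_mod_cast hk.ne'
  rw [Nat.cast_div hdk hd0]
  field_simp

/-! ### Splitting a sum over `ℤ` at `|h| ≤ H₀` -/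

/-- For a summable `g : ℤ → ℂ`:
`∑_{h ∈ ℤ} g(h) = g(0) + ∑_{1 ≤ h ≤ H₀} (g(h) + g(−h)) + ∑_{i ≥ 0} (g(i+H₀+1) + g(−(i+H₀+1)))`.
[folklore] -/
theorem tsum_int_eq_add_sum_add_tsum {g : ℤ → ℂ} (hg : Summable g) (H₀ : ℕ) :
    ∑' h : ℤ, g h = g 0 + ∑ h ∈ Finset.Icc 1 H₀, (g h + g (-(h : ℤ))) +
      ∑' i : ℕ, (g ((i + (H₀ + 1) : ℕ) : ℤ) + g (-((i + (H₀ + 1) : ℕ) : ℤ))) := by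
  have h1 : Summable fun n : ℕ => g n := hg.comp_injective Nat.cast_injective
  have h2 : Summable fun n : ℕ => g (-(n + 1 : ℤ)) :=
    hg.comp_injective fun a b hab => by simpa using hab
  rw [tsum_of_nat_of_neg_add_one h1 h2]
  have e1 := (h1.sum_add_tsum_nat_add (H₀ + 1)).symm
  have e2 := (h2.sum_add_tsum_nat_add H₀).symm
  rw [e1, e2, Finset.sum_range_succ' _ H₀]
  have e3 : ∑ h ∈ Finset.Icc 1 H₀, (g h + g (-(h : ℤ))) =
      ∑ i ∈ Finset.range H₀, (g ((i + 1 : ℕ) : ℤ) + g (-((i + 1 : ℕ) : ℤ))) := by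
    rw [← Finset.Ico_add_one_right_eq_Icc, Finset.sum_Ico_eq_sum_range, Nat.add_sub_cancel]
    refine Finset.sum_congr rfl fun i _ => ?_
    rw [add_comm 1 i]
  rw [e3, Finset.sum_add_distrib]
  have e4 : ∑' i : ℕ, (g ((i + (H₀ + 1) : ℕ) : ℤ) + g (-((i + (H₀ + 1) : ℕ) : ℤ))) =
      ∑' i : ℕ, g ((i + (H₀ + 1) : ℕ) : ℤ) + ∑' i : ℕ, g (-((i + (H₀ + 1) : ℕ) : ℤ)) := by
    refine Summable.tsum_add ?_ ?_
    · exact (summable_nat_add_iff (H₀ + 1)).2 h1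
    · have := (summable_nat_add_iff (f := fun n : ℕ => g (-(n + 1 : ℤ))) H₀).2 h2
      refine this.congr fun i => ?_
      push_cast; ring_nf
  rw [e4]
  have e5 : ∑' i : ℕ, g (-((i + (H₀ + 1) : ℕ) : ℤ)) = ∑' i : ℕ, g (-((i + H₀ : ℕ) + 1 : ℤ)) := by
    refine tsum_congr fun i => ?_
    push_cast; ring_nf
  rw [e5]
  push_cast
  ring

/-- The norm of a sum over `ℕ` is bounded by any uniform bound for the partial sums of norms.
[folklore] -/
theorem norm_tsum_nat_le_of_sum_range_le {u : ℕ → ℂ} (hu : Summable u) {C : ℝ}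
    (h : ∀ N : ℕ, ∑ i ∈ Finset.range N, ‖u i‖ ≤ C) : ‖∑' i, u i‖ ≤ C :=
  (norm_tsum_le_tsum_norm hu.norm).trans
    (Real.tsum_le_of_sum_range_le (fun _ => norm_nonneg _) h)

/-! ### The Fourier coefficients `Φ_k(h) = 𝓕α(h/k)` and their sums -/

/-- `Φ_k(h) = 𝓕α_ℂ(h/k)`, the `h`-th Fourier coefficient of the weight seen modulo `k`. [folklore] -/
def fcoef (M Y : ℝ) (k : ℕ) (h : ℤ) : ℂ := 𝓕 (bumpC M Y) ((h : ℝ) / k)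

/-- `fcoef` unfolded. [folklore] -/
theorem fcoef_def (M Y : ℝ) (k : ℕ) (h : ℤ) : fcoef M Y k h = 𝓕 (bumpC M Y) ((h : ℝ) / k) := rfl

/-- `Φ_k(0) = 𝓕α(0)` does not depend on `k`. [folklore] -/
theorem fcoef_zero (M Y : ℝ) (k : ℕ) : fcoef M Y k 0 = 𝓕 (bumpC M Y) 0 := by
  rw [fcoef_def, Int.cast_zero, zero_div]

/-- `h ↦ Φ_k(h)` is summable (`k ≥ 1`). [folklore] -/
theorem summable_fcoef {M Y : ℝ} (hY : 0 < Y) (hM : 0 ≤ M) {k : ℕ} (hk : 0 < k) :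
    Summable (fcoef M Y k) :=
  FriedlanderIwaniecPrimes.summable_fourier_div (contDiff_bumpC M Y) (hasCompactSupport_bumpC hY hM)
    (by exact_mod_cast hk)

/-- `|Φ_k(h)| ≤ M + 2Y`. [folklore] -/
theorem norm_fcoef_le {M Y : ℝ} (hY : 0 < Y) (hM : 0 ≤ M) (k : ℕ) (h : ℤ) :
    ‖fcoef M Y k h‖ ≤ M + 2 * Y :=
  norm_fourier_bumpC_le hY hM _

/-- `∑_{K < h ≤ N} h⁻ⁿ ≤ 2 (K+1)^{1−n}` for `n ≥ 2` and every `K ≥ 0`. [folklore] -/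
theorem sum_Ioc_inv_pow_le_two_mul {n : ℕ} (hn : 2 ≤ n) (K N : ℕ) :
    ∑ h ∈ Finset.Ioc K N, ((h : ℝ) ^ n)⁻¹ ≤ 2 * (((K : ℝ) + 1) ^ (n - 1))⁻¹ := by
  have hK1 : (0 : ℝ) < (K : ℝ) + 1 := by positivity
  rcases le_or_gt N K with hNK | hNK
  · rw [Finset.Ioc_eq_empty (by omega), Finset.sum_empty]; positivity
  · have hsplit := Finset.sum_Ioc_consecutive (fun h : ℕ => ((h : ℝ) ^ n)⁻¹)
      (Nat.le_succ K) (by omega : K + 1 ≤ N)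
    rw [← hsplit, Nat.Ioc_succ_singleton, Finset.sum_singleton]
    have h1 : (((K + 1 : ℕ) : ℝ) ^ n)⁻¹ ≤ (((K : ℝ) + 1) ^ (n - 1))⁻¹ := by
      push_cast
      refine inv_anti₀ (by positivity) ?_
      exact pow_le_pow_right₀ (by linarith) (by omega)
    have h2 := FriedlanderIwaniecPrimes.sum_Ioc_inv_pow_le hn (by omega : 1 ≤ K + 1) N
    push_cast at h2
    linarith

/-- **The tail of the dual sum** for the weight `α`: for `n ≥ 2`, `k ≥ 1` and every `K ≥ 0`,
`∑_{K < h ≤ N} (|Φ_k(h)| + |Φ_k(−h)|) ≤ 16 Kₙ Y⁻ⁿ Y (k/2π)ⁿ (K+1)^{1−n}` (repeated partial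
integration `|𝓕α(h/k)| ≤ ‖α⁽ⁿ⁾‖₁ (k/2π|h|)ⁿ` and `‖α⁽ⁿ⁾‖₁ ≤ 4KₙY^{1−n}`). [folklore] -/
theorem sum_Ioc_norm_fcoef_le {n : ℕ} (hn : 2 ≤ n) {M Y : ℝ} (hY : 0 < Y) (hM : 0 ≤ M) {k : ℕ}
    (hk : 0 < k) (K N : ℕ) :
    ∑ h ∈ Finset.Ioc K N, (‖fcoef M Y k h‖ + ‖fcoef M Y k (-(h : ℤ))‖) ≤
      16 * derivConst n * Y⁻¹ ^ n * Y * ((k : ℝ) / (2 * π)) ^ n * (((K : ℝ) + 1) ^ (n - 1))⁻¹ := by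
  have hkr : (0 : ℝ) < k := by exact_mod_cast hk
  set I : ℝ := ∫ t, ‖iteratedDeriv n (bumpC M Y) t‖ with hI
  have hI0 : 0 ≤ I := integral_nonneg fun _ => norm_nonneg _
  have hIle : I ≤ 4 * derivConst n * Y⁻¹ ^ n * Y :=
    integral_norm_iteratedDeriv_bumpC_le (by omega) hY hM
  have hterm : ∀ h ∈ Finset.Ioc K N, ‖fcoef M Y k h‖ + ‖fcoef M Y k (-(h : ℤ))‖ ≤
      2 * (I * ((k : ℝ) / (2 * π)) ^ n) * (((h : ℝ)) ^ n)⁻¹ := by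
    intro h hh
    rw [Finset.mem_Ioc] at hh
    have hh0 : 0 < |((h : ℤ) : ℝ)| := by
      rw [abs_pos]; exact_mod_cast (show (h : ℤ) ≠ 0 by omega)
    have hh0' : 0 < |((-(h : ℤ) : ℤ) : ℝ)| := by
      rw [abs_pos]; exact_mod_cast (show (-(h : ℤ) : ℤ) ≠ 0 by omega)
    have h1 := FriedlanderIwaniecPrimes.norm_fourier_div_le (contDiff_bumpC M Y)
      (hasCompactSupport_bumpC hY hM) n hkr hh0
    have h2 := FriedlanderIwaniecPrimes.norm_fourier_div_le (contDiff_bumpC M Y)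
      (hasCompactSupport_bumpC hY hM) n hkr hh0'
    rw [fcoef_def, fcoef_def]
    have e1 : |((h : ℤ) : ℝ)| = (h : ℝ) := by push_cast; exact abs_of_nonneg (by positivity)
    have e2 : |((-(h : ℤ) : ℤ) : ℝ)| = (h : ℝ) := by
      push_cast; rw [abs_neg]; exact abs_of_nonneg (by positivity)
    rw [e1] at h1
    rw [e2] at h2
    rw [← hI] at h1 h2
    linarith
  calc ∑ h ∈ Finset.Ioc K N, (‖fcoef M Y k h‖ + ‖fcoef M Y k (-(h : ℤ))‖)
      ≤ ∑ h ∈ Finset.Ioc K N, 2 * (I * ((k : ℝ) / (2 * π)) ^ n) * (((h : ℝ)) ^ n)⁻¹ :=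
        Finset.sum_le_sum hterm
    _ = 2 * (I * ((k : ℝ) / (2 * π)) ^ n) * ∑ h ∈ Finset.Ioc K N, (((h : ℝ)) ^ n)⁻¹ := by
        rw [Finset.mul_sum]
    _ ≤ 2 * (I * ((k : ℝ) / (2 * π)) ^ n) * (2 * (((K : ℝ) + 1) ^ (n - 1))⁻¹) :=
        mul_le_mul_of_nonneg_left (sum_Ioc_inv_pow_le_two_mul hn K N) (by positivity)
    _ ≤ 2 * ((4 * derivConst n * Y⁻¹ ^ n * Y) * ((k : ℝ) / (2 * π)) ^ n) *
          (2 * (((K : ℝ) + 1) ^ (n - 1))⁻¹) := by gcongr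
    _ = _ := by ring

/-- The tail bound `16 Kₙ Y⁻ⁿ Y (k/2π)ⁿ (K+1)^{1−n}` as a function (for statements). [folklore] -/
def tailBound (Y : ℝ) (n k K : ℕ) : ℝ :=
  16 * derivConst n * Y⁻¹ ^ n * Y * ((k : ℝ) / (2 * π)) ^ n * (((K : ℝ) + 1) ^ (n - 1))⁻¹

/-- `tailBound ≥ 0` for `Y > 0`. [folklore] -/
theorem tailBound_nonneg {Y : ℝ} (hY : 0 < Y) (n k K : ℕ) : 0 ≤ tailBound Y n k K := by
  unfold tailBound
  have := one_le_derivConst n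
  positivity

/-- **All non-zero frequencies**: for every split point `K ≥ 0`,
`∑_{1 ≤ h ≤ N} (|Φ_k(h)| + |Φ_k(−h)|) ≤ 2K(M + 2Y) + tailBound` (the first `K` terms trivially, the
rest by the tail bound). [folklore] -/
theorem sum_Icc_norm_fcoef_le {n : ℕ} (hn : 2 ≤ n) {M Y : ℝ} (hY : 0 < Y) (hM : 0 ≤ M) {k : ℕ}
    (hk : 0 < k) (K N : ℕ) :
    ∑ h ∈ Finset.Icc 1 N, (‖fcoef M Y k h‖ + ‖fcoef M Y k (-(h : ℤ))‖) ≤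
      2 * K * (M + 2 * Y) + tailBound Y n k K := by
  have hnn : ∀ h : ℕ, 0 ≤ ‖fcoef M Y k h‖ + ‖fcoef M Y k (-(h : ℤ))‖ := fun h => by positivity
  -- `Icc 1 N ⊆ Icc 1 (min K N) ∪ Ioc K N`... we bound by the sum over `Ioc 0 K ∪ Ioc K (max K N)`
  have hsub : Finset.Icc 1 N ⊆ Finset.Ioc 0 (max K N) := by
    intro h hh
    rw [Finset.mem_Icc] at hh
    rw [Finset.mem_Ioc]
    omega
  have hsplit := Finset.sum_Ioc_consecutive
    (fun h : ℕ => ‖fcoef M Y k h‖ + ‖fcoef M Y k (-(h : ℤ))‖) (Nat.zero_le K) (le_max_left K N)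
  calc ∑ h ∈ Finset.Icc 1 N, (‖fcoef M Y k h‖ + ‖fcoef M Y k (-(h : ℤ))‖)
      ≤ ∑ h ∈ Finset.Ioc 0 (max K N), (‖fcoef M Y k h‖ + ‖fcoef M Y k (-(h : ℤ))‖) :=
        Finset.sum_le_sum_of_subset_of_nonneg hsub fun h _ _ => hnn h
    _ = ∑ h ∈ Finset.Ioc 0 K, (‖fcoef M Y k h‖ + ‖fcoef M Y k (-(h : ℤ))‖) +
          ∑ h ∈ Finset.Ioc K (max K N), (‖fcoef M Y k h‖ + ‖fcoef M Y k (-(h : ℤ))‖) :=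
        hsplit.symm
    _ ≤ ∑ h ∈ Finset.Ioc 0 K, (M + 2 * Y + (M + 2 * Y)) + tailBound Y n k K := by
        refine add_le_add (Finset.sum_le_sum fun h _ =>
          add_le_add (norm_fcoef_le hY hM k h) (norm_fcoef_le hY hM k _)) ?_
        exact sum_Ioc_norm_fcoef_le hn hY hM hk K (max K N)
    _ = 2 * K * (M + 2 * Y) + tailBound Y n k K := by
        rw [Finset.sum_const, Nat.card_Ioc, Nat.sub_zero, nsmul_eq_mul]
        ring


/-! ### The congruence sums of the smoothed weight and their Poisson expansion -/

/-- `A(k, c) = ∑_{m ≡ c (k)} α(m)` (over `m ∈ mRange M Y`). [folklore] -/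
def classSum (M Y : ℝ) (k : ℕ) (c : ZMod k) : ℝ :=
  ∑ m ∈ (mRange M Y).filter (fun m : ℕ => (m : ZMod k) = c), bump M Y m

/-- `A*(k) = ∑_{(m, k) = 1} α(m)` (over `m ∈ mRange M Y`). [folklore] -/
def coprimeSum (M Y : ℝ) (k : ℕ) : ℝ :=
  ∑ m ∈ (mRange M Y).filter (fun m : ℕ => m.Coprime k), bump M Y m

/-- `α̂₀ = 𝓕α(0) = ∫ α`. [folklore] -/
def alphaHat (M Y : ℝ) : ℂ := 𝓕 (bumpC M Y) 0

/-- The twisted Fourier coefficient `e(ch/k) Φ_k(h)`. [folklore] -/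
def twCoef (M Y : ℝ) (k : ℕ) (c : ZMod k) (h : ℤ) : ℂ :=
  (𝐞 ((c.val : ℝ) * h / k) : ℂ) * fcoef M Y k h

/-- The truncated oscillatory sum `∑_{1 ≤ |h| ≤ H₀} e(ch/k) 𝓕α(h/k)` of BFI p. 236 (display after
(12.1)), written over `h ≥ 1` with the terms `±h` paired.
[cite: BombieriFriedlanderIwaniecActa1986, §12 p. 236] -/
def oscSum (M Y : ℝ) (k : ℕ) (c : ZMod k) (H₀ : ℕ) : ℂ :=
  ∑ h ∈ Finset.Icc 1 H₀, (twCoef M Y k c h + twCoef M Y k c (-(h : ℤ)))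

/-- `|twCoef| = |Φ_k(h)|`. [folklore] -/
theorem norm_twCoef (M Y : ℝ) (k : ℕ) (c : ZMod k) (h : ℤ) :
    ‖twCoef M Y k c h‖ = ‖fcoef M Y k h‖ := by
  rw [twCoef, norm_mul, Circle.norm_coe, one_mul]

/-- `h ↦ twCoef h` is summable. [folklore] -/
theorem summable_twCoef {M Y : ℝ} (hY : 0 < Y) (hM : 0 ≤ M) {k : ℕ} (hk : 0 < k) (c : ZMod k) :
    Summable (twCoef M Y k c) := by
  refine Summable.of_norm_bounded (summable_fcoef hY hM hk).norm fun h => ?_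
  rw [norm_twCoef]

/-- At the natural numbers where `α ≠ 0` we are inside `mRange`, and `α` vanishes at the negative
integers (`0 < Y ≤ M`): the hypotheses of `sum_filter_natCast_eq_tsum` for `F = α_ℂ`. [folklore] -/
theorem bumpC_hyps {M Y : ℝ} (hY : 0 < Y) (hYM : Y ≤ M) :
    (∀ m : ℕ, bumpC M Y m ≠ 0 → m ≤ ⌊2 * M + Y⌋₊) ∧ (∀ m : ℤ, m < 0 → bumpC M Y m = 0) := by
  have hM : 0 ≤ M := hY.le.trans hYM
  constructor
  · intro m hm
    have hm' : bump M Y m ≠ 0 := fun h => hm (by rw [bumpC_apply, h, Complex.ofReal_zero])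
    exact mem_mRange.1 (mem_mRange_of_bump_ne_zero hY hM hm')
  · intro m hm
    refine bumpC_eq_zero hY hM (Or.inl ?_)
    have : (m : ℝ) ≤ -1 := by exact_mod_cast (show m ≤ -1 by omega)
    linarith

/-- **Poisson expansion of one congruence sum** (BFI p. 236: "applying Lemma 2 we get
`∑_{m ≡ a n̄ (qr)} α(m) = (qr)⁻¹ ∑_{|h| ≤ H} α̂(h/qr) e(−ah n̄/qr) + O(…)`"), here with the exact tail:
for `k ≥ 1`, `0 < Y ≤ M`, every `H₀ ≥ 0` and `j ≥ 2`,
`‖A(k, c) − k⁻¹ (α̂₀ + oscSum(k, c, H₀))‖ ≤ k⁻¹ · tailBound(Y, j, k, H₀)`.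
[cite: BombieriFriedlanderIwaniecActa1986, §12 p. 236] -/
theorem norm_classSum_sub_le {M Y : ℝ} (hY : 0 < Y) (hYM : Y ≤ M) {k : ℕ} (hk : 0 < k)
    (c : ZMod k) (H₀ : ℕ) {j : ℕ} (hj : 2 ≤ j) :
    ‖(classSum M Y k c : ℂ) - (k : ℂ)⁻¹ * (alphaHat M Y + oscSum M Y k c H₀)‖ ≤
      (k : ℝ)⁻¹ * tailBound Y j k H₀ := by
  have hM : 0 ≤ M := hY.le.trans hYM
  haveI : NeZero k := ⟨hk.ne'⟩
  obtain ⟨hFL, hFneg⟩ := bumpC_hyps hY hYM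
  -- Poisson
  have hP := sum_filter_natCast_eq_tsum (contDiff_bumpC M Y) (hasCompactSupport_bumpC hY hM)
    hFL hFneg hk c
  have hA : (classSum M Y k c : ℂ) = (k : ℂ)⁻¹ * ∑' h : ℤ, twCoef M Y k c h := by
    rw [classSum, Complex.ofReal_sum]
    simp only [← bumpC_apply]
    exact hP
  -- split the dual sum
  have hsplit := tsum_int_eq_add_sum_add_tsum (summable_twCoef hY hM hk c) H₀
  have h0 : twCoef M Y k c 0 = alphaHat M Y := by
    rw [twCoef, fcoef_zero, alphaHat, Int.cast_zero, mul_zero, zero_div, AddChar.map_zero_eq_one,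
      Circle.coe_one, one_mul]
  rw [hA, hsplit, h0, ← oscSum]
  have hk0 : (k : ℂ) ≠ 0 := by exact_mod_cast hk.ne'
  rw [show (k : ℂ)⁻¹ * (alphaHat M Y + oscSum M Y k c H₀ +
      ∑' i : ℕ, (twCoef M Y k c ((i + (H₀ + 1) : ℕ) : ℤ) + twCoef M Y k c (-((i + (H₀ + 1) : ℕ) : ℤ)))) -
      (k : ℂ)⁻¹ * (alphaHat M Y + oscSum M Y k c H₀) =
      (k : ℂ)⁻¹ * ∑' i : ℕ, (twCoef M Y k c ((i + (H₀ + 1) : ℕ) : ℤ) +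
        twCoef M Y k c (-((i + (H₀ + 1) : ℕ) : ℤ))) by ring]
  rw [norm_mul, norm_inv, Complex.norm_natCast]
  refine mul_le_mul_of_nonneg_left ?_ (by positivity)
  -- the tail
  have hsum : Summable fun i : ℕ => twCoef M Y k c ((i + (H₀ + 1) : ℕ) : ℤ) +
      twCoef M Y k c (-((i + (H₀ + 1) : ℕ) : ℤ)) := by
    have h1 : Summable fun n : ℕ => twCoef M Y k c n :=
      (summable_twCoef hY hM hk c).comp_injective Nat.cast_injective
    have h2 : Summable fun n : ℕ => twCoef M Y k c (-(n : ℤ)) :=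
      (summable_twCoef hY hM hk c).comp_injective fun a b hab => by simpa using hab
    have h3 := ((summable_nat_add_iff (f := fun n : ℕ => twCoef M Y k c n) (H₀ + 1)).2 h1).add
      ((summable_nat_add_iff (f := fun n : ℕ => twCoef M Y k c (-(n : ℤ))) (H₀ + 1)).2 h2)
    exact h3
  refine norm_tsum_nat_le_of_sum_range_le hsum fun N' => ?_
  calc ∑ i ∈ Finset.range N', ‖twCoef M Y k c ((i + (H₀ + 1) : ℕ) : ℤ) +
          twCoef M Y k c (-((i + (H₀ + 1) : ℕ) : ℤ))‖
      ≤ ∑ i ∈ Finset.range N', (‖fcoef M Y k ((i + (H₀ + 1) : ℕ) : ℤ)‖ +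
          ‖fcoef M Y k (-((i + (H₀ + 1) : ℕ) : ℤ))‖) := by
        refine Finset.sum_le_sum fun i _ => (norm_add_le _ _).trans ?_
        rw [norm_twCoef, norm_twCoef]
    _ = ∑ h ∈ Finset.Ioc H₀ (H₀ + N'), (‖fcoef M Y k h‖ + ‖fcoef M Y k (-(h : ℤ))‖) := by
        rw [← Finset.Ico_add_one_add_one_eq_Ioc, Finset.sum_Ico_eq_sum_range]
        rw [show H₀ + N' + 1 - (H₀ + 1) = N' by omega]
        refine Finset.sum_congr rfl fun i _ => ?_
        rw [show H₀ + 1 + i = i + (H₀ + 1) by ring]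
    _ ≤ tailBound Y j k H₀ := sum_Ioc_norm_fcoef_le hj hY hM hk H₀ (H₀ + N')

/-- **The coprimality sum** (BFI p. 236: "`φ(qr)⁻¹ ∑_{(m,qr)=1} α(m) = (qr)⁻¹ α̂(0) + O(…)`"), by
Möbius inversion and Poisson summation modulo each `d ∣ k`: for `k ≥ 1`, `0 < Y ≤ M`, `j ≥ 2` and
any split points `K(d)`,
`‖A*(k) − α̂₀ φ(k)/k‖ ≤ ∑_{d ∣ k} d⁻¹ (2K(d)(M + 2Y) + tailBound(Y, j, d, K(d)))`.
[cite: BombieriFriedlanderIwaniecActa1986, §12 p. 236] -/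
theorem norm_coprimeSum_sub_le {M Y : ℝ} (hY : 0 < Y) (hYM : Y ≤ M) {k : ℕ} (hk : 0 < k)
    {j : ℕ} (hj : 2 ≤ j) (K : ℕ → ℕ) :
    ‖(coprimeSum M Y k : ℂ) - alphaHat M Y * ((Nat.totient k : ℂ) / k)‖ ≤
      ∑ d ∈ k.divisors, (d : ℝ)⁻¹ * (2 * K d * (M + 2 * Y) + tailBound Y j d (K d)) := by
  have hM : 0 ≤ M := hY.le.trans hYM
  obtain ⟨hFL, hFneg⟩ := bumpC_hyps hY hYM
  -- Möbius
  have hMo : (coprimeSum M Y k : ℂ) = ∑ d ∈ k.divisors, (ArithmeticFunction.moebius d : ℂ) *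
      ∑ m ∈ (mRange M Y).filter (fun m => d ∣ m), bumpC M Y m := by
    rw [coprimeSum, Complex.ofReal_sum]
    simp only [← bumpC_apply]
    exact sum_filter_coprime_eq_sum_divisors _ _ hk
  -- Poisson modulo each `d ∣ k`, with the tail `T d`
  set T : ℕ → ℂ := fun d => ∑' i : ℕ, (twCoef M Y d 0 ((i + (0 + 1) : ℕ) : ℤ) +
    twCoef M Y d 0 (-((i + (0 + 1) : ℕ) : ℤ))) with hT
  have hPd : ∀ d ∈ k.divisors, ∑ m ∈ (mRange M Y).filter (fun m => d ∣ m), bumpC M Y m =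
      (d : ℂ)⁻¹ * (alphaHat M Y + T d) := by
    intro d hd
    have hd0 : 0 < d := Nat.pos_of_mem_divisors hd
    haveI : NeZero d := ⟨hd0.ne'⟩
    have hfilter : (mRange M Y).filter (fun m => d ∣ m) =
        (Finset.range (⌊2 * M + Y⌋₊ + 1)).filter (fun m : ℕ => (m : ZMod d) = 0) := by
      rw [mRange]
      refine Finset.filter_congr fun m _ => ?_
      rw [ZMod.natCast_eq_zero_iff]
    rw [hfilter, sum_filter_natCast_eq_tsum (contDiff_bumpC M Y) (hasCompactSupport_bumpC hY hM)
      hFL hFneg hd0 0]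
    have hsplit := tsum_int_eq_add_sum_add_tsum (summable_twCoef hY hM hd0 0) 0
    have h0 : twCoef M Y d 0 0 = alphaHat M Y := by
      rw [twCoef, fcoef_zero, alphaHat, Int.cast_zero, mul_zero, zero_div, AddChar.map_zero_eq_one,
        Circle.coe_one, one_mul]
    have htw : (fun h : ℤ => (𝐞 (((0 : ZMod d).val : ℝ) * h / d) : ℂ) * 𝓕 (bumpC M Y) ((h : ℝ) / d)) =
        twCoef M Y d 0 := rfl
    rw [htw, hsplit, h0, Finset.Icc_eq_empty_of_lt (by norm_num : (0 : ℕ) < 1), Finset.sum_empty,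
      add_zero]
  -- bound for the tails
  have hTle : ∀ d ∈ k.divisors, ‖T d‖ ≤ 2 * K d * (M + 2 * Y) + tailBound Y j d (K d) := by
    intro d hd
    have hd0 : 0 < d := Nat.pos_of_mem_divisors hd
    have hsum : Summable fun i : ℕ => twCoef M Y d 0 ((i + (0 + 1) : ℕ) : ℤ) +
        twCoef M Y d 0 (-((i + (0 + 1) : ℕ) : ℤ)) := by
      have h1 : Summable fun n : ℕ => twCoef M Y d 0 n :=
        (summable_twCoef hY hM hd0 0).comp_injective Nat.cast_injective
      have h2 : Summable fun n : ℕ => twCoef M Y d 0 (-(n : ℤ)) :=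
        (summable_twCoef hY hM hd0 0).comp_injective fun a b hab => by simpa using hab
      have h3 := ((summable_nat_add_iff (f := fun n : ℕ => twCoef M Y d 0 n) (0 + 1)).2 h1).add
        ((summable_nat_add_iff (f := fun n : ℕ => twCoef M Y d 0 (-(n : ℤ))) (0 + 1)).2 h2)
      exact h3
    refine norm_tsum_nat_le_of_sum_range_le hsum fun N' => ?_
    calc ∑ i ∈ Finset.range N', ‖twCoef M Y d 0 ((i + (0 + 1) : ℕ) : ℤ) +
            twCoef M Y d 0 (-((i + (0 + 1) : ℕ) : ℤ))‖
        ≤ ∑ i ∈ Finset.range N', (‖fcoef M Y d ((i + (0 + 1) : ℕ) : ℤ)‖ +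
            ‖fcoef M Y d (-((i + (0 + 1) : ℕ) : ℤ))‖) := by
          refine Finset.sum_le_sum fun i _ => (norm_add_le _ _).trans ?_
          rw [norm_twCoef, norm_twCoef]
      _ = ∑ h ∈ Finset.Icc 1 N', (‖fcoef M Y d h‖ + ‖fcoef M Y d (-(h : ℤ))‖) := by
          rw [← Finset.Ico_add_one_right_eq_Icc, Finset.sum_Ico_eq_sum_range, Nat.add_sub_cancel]
          refine Finset.sum_congr rfl fun i _ => ?_
          rw [show 1 + i = i + (0 + 1) by ring]
      _ ≤ 2 * K d * (M + 2 * Y) + tailBound Y j d (K d) := sum_Icc_norm_fcoef_le hj hY hM hd0 (K d) N'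
  -- assemble
  have hmain : (coprimeSum M Y k : ℂ) - alphaHat M Y * ((Nat.totient k : ℂ) / k) =
      ∑ d ∈ k.divisors, (ArithmeticFunction.moebius d : ℂ) * (d : ℂ)⁻¹ * T d := by
    rw [hMo, Finset.sum_congr rfl fun d hd => by rw [hPd d hd], ← sum_divisors_moebius_div k hk,
      Finset.mul_sum, ← Finset.sum_sub_distrib]
    refine Finset.sum_congr rfl fun d _ => ?_
    ring
  rw [hmain]
  refine (norm_sum_le _ _).trans (Finset.sum_le_sum fun d hd => ?_)
  have hd0 : 0 < d := Nat.pos_of_mem_divisors hd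
  rw [norm_mul, norm_mul, norm_inv, Complex.norm_natCast]
  have hμ : ‖(ArithmeticFunction.moebius d : ℂ)‖ ≤ 1 := by
    rw [Complex.norm_intCast]
    exact_mod_cast ArithmeticFunction.abs_moebius_le_one
  calc ‖(ArithmeticFunction.moebius d : ℂ)‖ * (d : ℝ)⁻¹ * ‖T d‖ ≤ 1 * (d : ℝ)⁻¹ * ‖T d‖ := by
        gcongr
    _ ≤ 1 * (d : ℝ)⁻¹ * (2 * K d * (M + 2 * Y) + tailBound Y j d (K d)) :=
        mul_le_mul_of_nonneg_left (hTle d hd) (by positivity)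
    _ = _ := by ring


/-! ### The bracket of `𝒟` at one modulus and its expansion -/

/-- The bracket of (3.1) at the modulus `k` for the weight `w` on `S`:
`∑_{m∈S, n∼N, mn≡a (k)} w(m)β_n − φ(k)⁻¹ ∑_{(mn,k)=1} w(m)β_n`.
[cite: BombieriFriedlanderIwaniecActa1986, §3 (3.1) p. 214] -/
def bracketW (a : ℤ) (S : Finset ℕ) (N : ℝ) (w β : ℕ → ℝ) (k : ℕ) : ℝ :=
  (∑ m ∈ S, ∑ n ∈ dyadic N,
      if ((m * n : ℕ) : ZMod k) = (a : ZMod k) then w m * β n else 0) -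
    (∑ m ∈ S, ∑ n ∈ dyadic N, if (m * n).Coprime k then w m * β n else 0) / (Nat.totient k : ℝ)

/-- `dispDw = ∑_{q∼Q, r∼R, (qr,a)=1} γ_q δ_r · bracketW(qr)`. [folklore] -/
theorem dispDw_eq_sum_bracketW (a : ℤ) (S : Finset ℕ) (N Q R : ℝ) (w β γ δ : ℕ → ℝ) :
    dispDw a S N Q R w β γ δ = ∑ q ∈ dyadic Q, ∑ r ∈ dyadic R,
      if IsCoprime ((q * r : ℕ) : ℤ) a then γ q * δ r * bracketW a S N w β (q * r) else 0 := rfl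

/-- For `(n, k) = 1`: `mn ≡ a (mod k) ↔ m ≡ a n̄ (mod k)`. [folklore] -/
theorem natCast_mul_eq_iff {k m n : ℕ} (hn : n.Coprime k) (a : ZMod k) :
    ((m * n : ℕ) : ZMod k) = a ↔ (m : ZMod k) = a * ((n : ZMod k))⁻¹ := by
  have hu : (n : ZMod k) * ((n : ZMod k))⁻¹ = 1 := ZMod.coe_mul_inv_eq_one n hn
  rw [Nat.cast_mul]
  constructor
  · intro h; rw [← h, mul_assoc, hu, mul_one]
  · intro h; rw [h, mul_assoc, mul_comm ((n : ZMod k))⁻¹, hu, mul_one]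

/-- **Rearrangement of the congruence sum**: for `(k, a) = 1`, only `n` coprime to `k` contribute,
and then `mn ≡ a (k)` means `m ≡ a n̄ (k)`:
`∑_{m, n, mn ≡ a (k)} w(m) β_n = ∑_{n∼N, (n,k)=1} β_n ∑_{m ≡ a n̄ (k)} w(m)`. [folklore] -/
theorem sum_congr_eq_sum_filter {a : ℤ} {k : ℕ} (hka : IsCoprime (k : ℤ) a) (S : Finset ℕ)
    (N : ℝ) (w β : ℕ → ℝ) :
    ∑ m ∈ S, ∑ n ∈ dyadic N,
        (if ((m * n : ℕ) : ZMod k) = (a : ZMod k) then w m * β n else 0) =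
      ∑ n ∈ (dyadic N).filter (fun n => n.Coprime k),
        β n * ∑ m ∈ S.filter (fun m : ℕ => (m : ZMod k) = (a : ZMod k) * ((n : ZMod k))⁻¹), w m := by
  rw [Finset.sum_comm, Finset.sum_filter]
  refine Finset.sum_congr rfl fun n _ => ?_
  by_cases hn : n.Coprime k
  · rw [if_pos hn, Finset.sum_filter, Finset.mul_sum]
    refine Finset.sum_congr rfl fun m _ => ?_
    by_cases h : (m : ZMod k) = (a : ZMod k) * ((n : ZMod k))⁻¹
    · rw [if_pos h, if_pos ((natCast_mul_eq_iff hn _).2 h)]; ring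
    · rw [if_neg h, if_neg (mt (natCast_mul_eq_iff hn _).1 h)]; ring
  · rw [if_neg hn]
    refine Finset.sum_eq_zero fun m _ => ?_
    rw [if_neg]
    intro h
    rw [mul_comm] at h
    exact hn (coprime_of_natCast_mul_eq hka h).symm

/-- **Rearrangement of the coprimality sum**:
`∑_{m, n, (mn,k)=1} w(m) β_n = (∑_{n∼N, (n,k)=1} β_n) (∑_{(m,k)=1} w(m))`. [folklore] -/
theorem sum_coprime_eq_mul (k : ℕ) (S : Finset ℕ) (N : ℝ) (w β : ℕ → ℝ) :
    ∑ m ∈ S, ∑ n ∈ dyadic N, (if (m * n).Coprime k then w m * β n else 0) =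
      (∑ n ∈ (dyadic N).filter (fun n => n.Coprime k), β n) *
        ∑ m ∈ S.filter (fun m : ℕ => m.Coprime k), w m := by
  rw [Finset.sum_comm, Finset.sum_filter, Finset.sum_mul]
  refine Finset.sum_congr rfl fun n _ => ?_
  by_cases hn : n.Coprime k
  · rw [if_pos hn, Finset.sum_filter, Finset.mul_sum]
    refine Finset.sum_congr rfl fun m _ => ?_
    have : (m * n).Coprime k ↔ m.Coprime k :=
      ⟨fun h => Nat.Coprime.coprime_mul_right h, fun h => Nat.Coprime.mul_left h hn⟩
    simp only [this]
    split_ifs <;> ring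
  · rw [if_neg hn, zero_mul]
    refine Finset.sum_eq_zero fun m _ => ?_
    rw [if_neg]
    intro h
    exact hn (Nat.Coprime.coprime_mul_left h)

/-- **The bracket at one modulus after Poisson summation** (BFI p. 236, the display "Hence
`𝒟(M,N,Q,R) = ∑∑ γ_q δ_r (qr)⁻¹ ∑_{(n,qr)=1} β_n ∑_{1≤|h|≤H} α̂(h/qr) e(−ahn̄/qr) + O(…)`", one
modulus `k = qr` at a time, with explicit error terms): for `k ≥ 1` coprime to `a`, `0 < Y ≤ M`,
`H₀ ≥ 0`, `j ≥ 2` and split points `K(d)`,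
`‖bracketW(k; α) − k⁻¹ ∑_{n∼N,(n,k)=1} β_n oscSum(k, a n̄, H₀)‖
   ≤ ∑_n |β_n| · (k⁻¹ tailBound(Y,j,k,H₀) + φ(k)⁻¹ ∑_{d∣k} d⁻¹ (2K(d)(M+2Y) + tailBound(Y,j,d,K(d))))`:
the main terms `α̂₀/k` of the congruence and coprimality sums cancel exactly.
[cite: BombieriFriedlanderIwaniecActa1986, §12 p. 236] -/
theorem norm_bracketW_bump_sub_le {a : ℤ} {M Y : ℝ} (hY : 0 < Y) (hYM : Y ≤ M) (N : ℝ) {k : ℕ}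
    (hk : 0 < k) (hka : IsCoprime (k : ℤ) a) (β : ℕ → ℝ) (H₀ : ℕ) {j : ℕ} (hj : 2 ≤ j)
    (K : ℕ → ℕ) :
    ‖((bracketW a (mRange M Y) N (fun m => bump M Y m) β k : ℝ) : ℂ) -
        (k : ℂ)⁻¹ * ∑ n ∈ (dyadic N).filter (fun n => n.Coprime k),
          (β n : ℂ) * oscSum M Y k ((a : ZMod k) * ((n : ZMod k))⁻¹) H₀‖ ≤
      (∑ n ∈ dyadic N, |β n|) *
        ((k : ℝ)⁻¹ * tailBound Y j k H₀ +
          (∑ d ∈ k.divisors, (d : ℝ)⁻¹ * (2 * K d * (M + 2 * Y) + tailBound Y j d (K d))) /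
            (Nat.totient k : ℝ)) := by
  set F : Finset ℕ := (dyadic N).filter (fun n => n.Coprime k) with hF
  set c : ℕ → ZMod k := fun n => (a : ZMod k) * ((n : ZMod k))⁻¹ with hc
  set Scls : ℂ := ∑ n ∈ F, (β n : ℂ) * (classSum M Y k (c n) : ℂ) with hScls
  set Sosc : ℂ := ∑ n ∈ F, (β n : ℂ) * oscSum M Y k (c n) H₀ with hSosc
  set Sβ : ℂ := ∑ n ∈ F, (β n : ℂ) with hSβ
  set cop : ℂ := (coprimeSum M Y k : ℂ) with hcop
  set φ : ℂ := (Nat.totient k : ℂ) with hφ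
  have hφ0 : φ ≠ 0 := by rw [hφ]; exact_mod_cast (Nat.totient_pos.2 hk).ne'
  have hk0 : (k : ℂ) ≠ 0 := by exact_mod_cast hk.ne'
  have hM : 0 ≤ M := hY.le.trans hYM
  set errB : ℝ := ∑ d ∈ k.divisors, (d : ℝ)⁻¹ * (2 * K d * (M + 2 * Y) + tailBound Y j d (K d))
    with herrB
  -- the bracket in terms of `classSum` and `coprimeSum`
  have hbr : ((bracketW a (mRange M Y) N (fun m => bump M Y m) β k : ℝ) : ℂ) =
      Scls - Sβ * cop / φ := by
    rw [bracketW, sum_congr_eq_sum_filter hka, sum_coprime_eq_mul]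
    simp only [hScls, hSβ, hcop, hφ, hF, hc, classSum, coprimeSum]
    push_cast
    ring
  -- the algebraic recombination (the main terms `α̂₀/k` cancel)
  have hid : (Scls - Sβ * cop / φ) - (k : ℂ)⁻¹ * Sosc =
      (Scls - (k : ℂ)⁻¹ * (alphaHat M Y * Sβ + Sosc)) -
        Sβ * (cop - alphaHat M Y * (φ / k)) / φ := by
    field_simp
    ring
  have hT1 : Scls - (k : ℂ)⁻¹ * (alphaHat M Y * Sβ + Sosc) =
      ∑ n ∈ F, (β n : ℂ) * ((classSum M Y k (c n) : ℂ) -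
        (k : ℂ)⁻¹ * (alphaHat M Y + oscSum M Y k (c n) H₀)) := by
    simp only [hScls, hSosc, hSβ, mul_sub, mul_add, Finset.sum_sub_distrib, Finset.sum_add_distrib,
      Finset.mul_sum]
    congr 1
    congr 1 <;> refine Finset.sum_congr rfl fun n _ => ?_ <;> ring
  rw [hbr, hid, hT1]
  refine (norm_sub_le _ _).trans ?_
  have hβF : ∑ n ∈ F, |β n| ≤ ∑ n ∈ dyadic N, |β n| :=
    Finset.sum_le_sum_of_subset_of_nonneg (Finset.filter_subset _ _) fun n _ _ => abs_nonneg _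
  have hβ0 : 0 ≤ ∑ n ∈ dyadic N, |β n| := Finset.sum_nonneg fun n _ => abs_nonneg _
  have htail0 : 0 ≤ (k : ℝ)⁻¹ * tailBound Y j k H₀ := by
    have := tailBound_nonneg hY j k H₀; positivity
  have herr0 : 0 ≤ errB := by
    refine Finset.sum_nonneg fun d _ => ?_
    have := tailBound_nonneg hY j d (K d); positivity
  -- first term
  have h1 : ‖∑ n ∈ F, (β n : ℂ) * ((classSum M Y k (c n) : ℂ) -
      (k : ℂ)⁻¹ * (alphaHat M Y + oscSum M Y k (c n) H₀))‖ ≤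
      (∑ n ∈ dyadic N, |β n|) * ((k : ℝ)⁻¹ * tailBound Y j k H₀) := by
    refine (norm_sum_le _ _).trans ?_
    calc ∑ n ∈ F, ‖(β n : ℂ) * ((classSum M Y k (c n) : ℂ) -
          (k : ℂ)⁻¹ * (alphaHat M Y + oscSum M Y k (c n) H₀))‖
        ≤ ∑ n ∈ F, |β n| * ((k : ℝ)⁻¹ * tailBound Y j k H₀) := by
          refine Finset.sum_le_sum fun n _ => ?_
          rw [norm_mul, Complex.norm_real, Real.norm_eq_abs]
          exact mul_le_mul_of_nonneg_left (norm_classSum_sub_le hY hYM hk (c n) H₀ hj)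
            (abs_nonneg _)
      _ = (∑ n ∈ F, |β n|) * ((k : ℝ)⁻¹ * tailBound Y j k H₀) := by rw [Finset.sum_mul]
      _ ≤ (∑ n ∈ dyadic N, |β n|) * ((k : ℝ)⁻¹ * tailBound Y j k H₀) :=
          mul_le_mul_of_nonneg_right hβF htail0
  -- second term
  have h2 : ‖Sβ * (cop - alphaHat M Y * (φ / k)) / φ‖ ≤
      (∑ n ∈ dyadic N, |β n|) * (errB / (Nat.totient k : ℝ)) := by
    rw [norm_div, norm_mul, hφ, Complex.norm_natCast]
    have hSβ_le : ‖Sβ‖ ≤ ∑ n ∈ dyadic N, |β n| := by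
      refine (norm_sum_le _ _).trans (le_trans (le_of_eq ?_) hβF)
      refine Finset.sum_congr rfl fun n _ => ?_
      rw [Complex.norm_real, Real.norm_eq_abs]
    have hE2 := norm_coprimeSum_sub_le hY hYM hk hj K
    rw [← hcop, ← herrB] at hE2
    have hφpos : (0 : ℝ) < (Nat.totient k : ℝ) := by exact_mod_cast Nat.totient_pos.2 hk
    rw [mul_div_assoc]
    have hE2' : ‖cop - alphaHat M Y * (φ / k)‖ / (Nat.totient k : ℝ) ≤ errB / (Nat.totient k : ℝ) :=
      by rw [div_le_div_iff_of_pos_right hφpos]; exact hE2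
    exact mul_le_mul hSβ_le hE2' (by positivity) hβ0
  calc ‖∑ n ∈ F, (β n : ℂ) * ((classSum M Y k (c n) : ℂ) -
        (k : ℂ)⁻¹ * (alphaHat M Y + oscSum M Y k (c n) H₀))‖ +
        ‖Sβ * (cop - alphaHat M Y * (φ / k)) / φ‖
      ≤ (∑ n ∈ dyadic N, |β n|) * ((k : ℝ)⁻¹ * tailBound Y j k H₀) +
          (∑ n ∈ dyadic N, |β n|) * (errB / (Nat.totient k : ℝ)) := add_le_add h1 h2
    _ = _ := by rw [herrB]; ring



end BFI

end Literature.NumberTheory.Sieve
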